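import Literature.MathematicalPhysics.QuantumManyBody.PenroseOnsager1956

/-!
# Penrose–Onsager 1956: proofs of (17)–(18) and of (20) `n_Ψ ≅ n_M`

Discharge of the named literature fact
`Literature.MathematicalPhysics.QuantumManyBody.BoseGas.PenroseOnsager.PenroseOnsager1956_eq18`
of `PenroseOnsager1956.lean` (O. Penrose, L. Onsager, *Bose–Einstein condensation and liquid
helium*, Phys. Rev. **104** (1956) 576–584, §4 (17)–(18)): along a sequence of systems in
containers `Λ_N ⊂ ℝ³` of volume `V = N/ρ` whose reduced density matrices have the asymptotic form
(13) `|⟨q'|σ₁|q''⟩ - Ψ(q')Ψ*(q'')| ≤ ρ γ(|q' - q''|)` with `0 ≤ γ ≤ γ_M`, `γ(r) → 0` (14),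
`A₁ = (NV)⁻¹ [∫_V |Ψ| d³x]² + o(1)`.

The printed argument [cite: PenroseOnsager1956, §4 (15)–(18)]: by (13) and Lemma (15)
(`setLIntegral_radial_le_of_tendsto_zero`),
`(NV)⁻¹ ∫∫ |⟨q'|σ₁|q''⟩ - Ψ(q')Ψ*(q'')| d³q' d³q'' ≤ (NV)⁻¹ ρ ∫_V V Γ = o(1)` — this is (17) — and
then `| |⟨q'|σ₁|q''⟩| - |Ψ(q')| |Ψ(q'')| | ≤ |⟨q'|σ₁|q''⟩ - Ψ(q')Ψ*(q'')|` integrated over `V × V`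
gives (18), since `∫∫ |Ψ(q')| |Ψ(q'')| = [∫ |Ψ|]²`. We run the argument in `ℝ≥0∞` (the error
kernel `γ(|q' - q''|)` is not assumed measurable, so the Tonelli step for it is the inequality
`lintegral_prod_le`), as the two-sided bound `∫∫|σ₁| ≤ [∫|Ψ|]² + ρ ε V²`,
`[∫|Ψ|]² ≤ ∫∫|σ₁| + ρ ε V²` (`lintegral_kernel_le_sq_add_and_sq_le`), and pass to real numbers at
the end (`ρ ε V² / (N V) = ε`).

The second part of the file discharges the named fact `PenroseOnsager1956_eq20`
(`PenroseOnsager1956_eq20_holds`, [cite: PenroseOnsager1956, §4 (20)–(22)]); its argument is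
described in the module docstring opening that part.

## References

* [PenroseOnsager1956] O. Penrose, L. Onsager, *Bose–Einstein condensation and liquid helium*,
  Phys. Rev. 104 (1956) 576–584, doi:10.1103/PhysRev.104.576: §4 (13)–(22), Lemma (15)–(16).
-/

noncomputable section

open MeasureTheory Filter Metric Topology Function
open scoped ENNReal NNReal ComplexConjugate

namespace Literature.MathematicalPhysics.QuantumManyBody.BoseGas.PenroseOnsager

/-- Pointwise form of `| |u| - |v| | ≤ |u - v|` behind (18), in `ℝ≥0∞`: if
`|σ - Ψ(q')Ψ*(q'')| ≤ e` then `|σ| ≤ |Ψ(q')| |Ψ(q'')| + e` and `|Ψ(q')| |Ψ(q'')| ≤ |σ| + e`.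
[cite: PenroseOnsager1956, §4 (17)–(18)] -/
theorem coe_nnnorm_le_add_of_norm_sub_mul_conj_le {s a b : ℂ} {e : ℝ}
    (h : ‖s - a * conj b‖ ≤ e) :
    (‖s‖₊ : ℝ≥0∞) ≤ ‖a‖₊ * ‖b‖₊ + ENNReal.ofReal e ∧
      (‖a‖₊ : ℝ≥0∞) * ‖b‖₊ ≤ ‖s‖₊ + ENNReal.ofReal e := by
  have he : 0 ≤ e := (norm_nonneg _).trans h
  have hab : ‖a * conj b‖ = ‖a‖ * ‖b‖ := by rw [norm_mul, Complex.norm_conj]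
  have h1 : ‖s‖ ≤ ‖a‖ * ‖b‖ + e := by
    calc ‖s‖ ≤ ‖a * conj b‖ + ‖s - a * conj b‖ := norm_le_norm_add_norm_sub' s _
      _ ≤ ‖a‖ * ‖b‖ + e := by rw [hab]; exact add_le_add le_rfl h
  have h2 : ‖a‖ * ‖b‖ ≤ ‖s‖ + e := by
    calc ‖a‖ * ‖b‖ = ‖a * conj b‖ := hab.symm
      _ ≤ ‖s‖ + ‖s - a * conj b‖ := norm_le_norm_add_norm_sub s _
      _ ≤ ‖s‖ + e := add_le_add le_rfl h
  change ‖s‖ₑ ≤ ‖a‖ₑ * ‖b‖ₑ + ENNReal.ofReal e ∧ ‖a‖ₑ * ‖b‖ₑ ≤ ‖s‖ₑ + ENNReal.ofReal e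
  rw [← ofReal_norm, ← ofReal_norm, ← ofReal_norm, ← ENNReal.ofReal_mul (norm_nonneg a),
    ← ENNReal.ofReal_add (mul_nonneg (norm_nonneg a) (norm_nonneg b)) he,
    ← ENNReal.ofReal_add (norm_nonneg s) he]
  exact ⟨ENNReal.ofReal_le_ofReal h1, ENNReal.ofReal_le_ofReal h2⟩

/-- `|a - b| ≤ c` for the real parts, from the two-sided bound `a ≤ b + c`, `b ≤ a + c` in `ℝ≥0∞`
with `b`, `c` finite. [folklore] -/
theorem abs_toReal_sub_toReal_le {a b c : ℝ≥0∞} (h₁ : a ≤ b + c) (h₂ : b ≤ a + c) (hb : b ≠ ∞)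
    (hc : c ≠ ∞) : |a.toReal - b.toReal| ≤ c.toReal := by
  have ha : a ≠ ∞ := ne_top_of_le_ne_top (ENNReal.add_ne_top.2 ⟨hb, hc⟩) h₁
  have h₁' := ENNReal.toReal_mono (ENNReal.add_ne_top.2 ⟨hb, hc⟩) h₁
  have h₂' := ENNReal.toReal_mono (ENNReal.add_ne_top.2 ⟨ha, hc⟩) h₂
  rw [ENNReal.toReal_add hb hc] at h₁'
  rw [ENNReal.toReal_add ha hc] at h₂'
  rw [abs_sub_le_iff]
  constructor <;> linarith

/-- **(17) in two-sided form, for one system.** On a measurable container `Λ ⊂ ℝ³`, if (13) holds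
on `Λ × Λ` with `ρ ≥ 0` and `∫_Λ γ(|x' - x|) d³x' ≤ B` for every `x` (the bound of Lemma (15)),
then `∫_Λ∫_Λ |⟨q'|σ₁|q''⟩| ≤ [∫_Λ |Ψ|]² + ρ B V` and `[∫_Λ |Ψ|]² ≤ ∫_Λ∫_Λ |⟨q'|σ₁|q''⟩| + ρ B V`,
`V = vol Λ`. [cite: PenroseOnsager1956, §4 (13), (15), (17)] -/
theorem lintegral_kernel_le_sq_add_and_sq_le {Λ : Set Space} (hΛ : MeasurableSet Λ)
    {σ : Space → Space → ℂ} (hσ : Measurable (uncurry σ)) {Ψ : Space → ℂ}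
    (hΨ : AEStronglyMeasurable Ψ (volume.restrict Λ)) {ρ : ℝ} (hρ : 0 ≤ ρ) {γ : ℝ → ℝ}
    (h13 : HasAsymptoticForm ρ σ Ψ γ Λ) {B : ℝ≥0∞}
    (hB : ∀ x, ∫⁻ x' in Λ, ENNReal.ofReal (γ (dist x' x)) ≤ B) :
    ∫⁻ p, (‖σ p.1 p.2‖₊ : ℝ≥0∞) ∂(volume.restrict Λ).prod (volume.restrict Λ) ≤
        (∫⁻ x in Λ, (‖Ψ x‖₊ : ℝ≥0∞)) ^ 2 + ENNReal.ofReal ρ * B * volume Λ ∧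
      (∫⁻ x in Λ, (‖Ψ x‖₊ : ℝ≥0∞)) ^ 2 ≤
        ∫⁻ p, (‖σ p.1 p.2‖₊ : ℝ≥0∞) ∂(volume.restrict Λ).prod (volume.restrict Λ) +
          ENNReal.ofReal ρ * B * volume Λ := by
  set μ : Measure Space := volume.restrict Λ with hμ
  have hmem : ∀ᵐ p ∂μ.prod μ, p ∈ Λ ×ˢ Λ := by
    rw [hμ, Measure.prod_restrict]
    exact ae_restrict_mem (hΛ.prod hΛ)
  have hΨm : AEMeasurable (fun x => (‖Ψ x‖₊ : ℝ≥0∞)) μ :=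
    hΨ.aemeasurable.nnnorm.coe_nnreal_ennreal
  have hσm : AEMeasurable (fun p : Space × Space => (‖σ p.1 p.2‖₊ : ℝ≥0∞)) (μ.prod μ) :=
    hσ.nnnorm.coe_nnreal_ennreal.aemeasurable
  have hJ : ∫⁻ p, (‖Ψ p.1‖₊ : ℝ≥0∞) * ‖Ψ p.2‖₊ ∂μ.prod μ = (∫⁻ x, (‖Ψ x‖₊ : ℝ≥0∞) ∂μ) ^ 2 := by
    rw [lintegral_prod_mul hΨm hΨm, sq]
  -- (17): the error term, by the Tonelli inequality and the bound `hB` of Lemma (15)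
  have hE : ∫⁻ p, ENNReal.ofReal (ρ * γ (dist p.2 p.1)) ∂μ.prod μ ≤
      ENNReal.ofReal ρ * B * volume Λ := by
    calc ∫⁻ p, ENNReal.ofReal (ρ * γ (dist p.2 p.1)) ∂μ.prod μ
        ≤ ∫⁻ q', ∫⁻ q'', ENNReal.ofReal (ρ * γ (dist q'' q')) ∂μ ∂μ :=
          lintegral_prod_le (fun p : Space × Space => ENNReal.ofReal (ρ * γ (dist p.2 p.1)))
      _ ≤ ∫⁻ _, ENNReal.ofReal ρ * B ∂μ := by
          refine lintegral_mono fun q' => ?_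
          calc ∫⁻ q'', ENNReal.ofReal (ρ * γ (dist q'' q')) ∂μ
              = ∫⁻ q'', ENNReal.ofReal ρ * ENNReal.ofReal (γ (dist q'' q')) ∂μ := by
                simp_rw [ENNReal.ofReal_mul hρ]
            _ = ENNReal.ofReal ρ * ∫⁻ q'', ENNReal.ofReal (γ (dist q'' q')) ∂μ :=
                lintegral_const_mul' _ _ ENNReal.ofReal_ne_top
            _ ≤ ENNReal.ofReal ρ * B := mul_le_mul' le_rfl (hB q')
      _ = ENNReal.ofReal ρ * B * volume Λ := by
          rw [lintegral_const, hμ, Measure.restrict_apply_univ]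
  -- (13) pointwise, a.e. on `Λ × Λ`
  have hpt : ∀ᵐ p ∂μ.prod μ,
      (‖σ p.1 p.2‖₊ : ℝ≥0∞) ≤ ‖Ψ p.1‖₊ * ‖Ψ p.2‖₊ + ENNReal.ofReal (ρ * γ (dist p.2 p.1)) ∧
        (‖Ψ p.1‖₊ : ℝ≥0∞) * ‖Ψ p.2‖₊ ≤ ‖σ p.1 p.2‖₊ + ENNReal.ofReal (ρ * γ (dist p.2 p.1)) := by
    filter_upwards [hmem] with p hp
    obtain ⟨hp₁, hp₂⟩ := Set.mem_prod.1 hp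
    have h := h13 p.1 hp₁ p.2 hp₂
    rw [dist_comm] at h
    exact coe_nnnorm_le_add_of_norm_sub_mul_conj_le h
  constructor
  · calc ∫⁻ p, (‖σ p.1 p.2‖₊ : ℝ≥0∞) ∂μ.prod μ
        ≤ ∫⁻ p, ((‖Ψ p.1‖₊ : ℝ≥0∞) * ‖Ψ p.2‖₊ + ENNReal.ofReal (ρ * γ (dist p.2 p.1))) ∂μ.prod μ :=
          lintegral_mono_ae (hpt.mono fun p hp => hp.1)
      _ = ∫⁻ p, (‖Ψ p.1‖₊ : ℝ≥0∞) * ‖Ψ p.2‖₊ ∂μ.prod μ +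
            ∫⁻ p, ENNReal.ofReal (ρ * γ (dist p.2 p.1)) ∂μ.prod μ :=
          lintegral_add_left' (hΨm.comp_fst.mul hΨm.comp_snd) _
      _ ≤ (∫⁻ x, (‖Ψ x‖₊ : ℝ≥0∞) ∂μ) ^ 2 + ENNReal.ofReal ρ * B * volume Λ := by
          rw [hJ]
          exact add_le_add le_rfl hE
  · calc (∫⁻ x, (‖Ψ x‖₊ : ℝ≥0∞) ∂μ) ^ 2
        = ∫⁻ p, (‖Ψ p.1‖₊ : ℝ≥0∞) * ‖Ψ p.2‖₊ ∂μ.prod μ := hJ.symm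
      _ ≤ ∫⁻ p, ((‖σ p.1 p.2‖₊ : ℝ≥0∞) + ENNReal.ofReal (ρ * γ (dist p.2 p.1))) ∂μ.prod μ :=
          lintegral_mono_ae (hpt.mono fun p hp => hp.2)
      _ = ∫⁻ p, (‖σ p.1 p.2‖₊ : ℝ≥0∞) ∂μ.prod μ +
            ∫⁻ p, ENNReal.ofReal (ρ * γ (dist p.2 p.1)) ∂μ.prod μ :=
          lintegral_add_left' hσm _
      _ ≤ ∫⁻ p, (‖σ p.1 p.2‖₊ : ℝ≥0∞) ∂μ.prod μ + ENNReal.ofReal ρ * B * volume Λ :=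
          add_le_add le_rfl hE

/-- **(17)–(18) hold** [cite: PenroseOnsager1956, §4 (17)–(18)]: discharge of the named fact
`PenroseOnsager1956_eq18`, following the printed proof — (13) and Lemma (15)
(`setLIntegral_radial_le_of_tendsto_zero`, with `ε/2`) give (17) in the two-sided form
`lintegral_kernel_le_sq_add_and_sq_le` once `V = N/ρ ≥ V₀(ε/2)`, i.e. for all large `N`; dividing
by `N V` the error is `ρ (ε/2) V² / (N V) = ε/2 < ε`. -/
theorem PenroseOnsager1956_eq18_holds : PenroseOnsager1956_eq18 := by
  intro ρ Λ σ Ψ γ γM hρ hΛ hV hσ hΨ hγ0 hγM hγ h13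
  rw [Metric.tendsto_nhds]
  intro ε hε
  -- Lemma (15) with `ε/2`: a volume threshold `V₀`
  obtain ⟨V₀, hV₀, h15⟩ :=
    setLIntegral_radial_le_of_tendsto_zero (volume : Measure Space) hγ0 hγM hγ (half_pos hε)
  -- `V = N/ρ ≥ V₀` for all large `N`
  have hlarge : ∀ᶠ N : ℕ in atTop, V₀ ≤ volume (Λ N) := by
    obtain ⟨N₀, hN₀⟩ := exists_nat_ge (ρ * V₀.toReal)
    filter_upwards [hV, eventually_ge_atTop N₀] with N hVN hN
    rw [hVN, ← ENNReal.ofReal_toReal hV₀]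
    refine ENNReal.ofReal_le_ofReal ?_
    rw [le_div_iff₀ hρ, mul_comm]
    exact hN₀.trans (Nat.cast_le.2 hN)
  filter_upwards [hV, hlarge, h13, eventually_gt_atTop 0] with N hVN hVl h13N hN0
  have hN : (0 : ℝ) < N := Nat.cast_pos.2 hN0
  have hVr : (0 : ℝ) < N / ρ := div_pos hN hρ
  -- (17), two-sided, for the `N`-th system
  obtain ⟨h₁, h₂⟩ := lintegral_kernel_le_sq_add_and_sq_le (hΛ N) (hσ N)
    (hΨ N).aestronglyMeasurable hρ.le h13N (h15 (Λ N) (hΛ N) hVl)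
  have hL : ∫⁻ x in Λ N, (‖Ψ N x‖₊ : ℝ≥0∞) ≠ ∞ := (hΨ N).hasFiniteIntegral.ne
  have hE : ENNReal.ofReal ρ * (ENNReal.ofReal (ε / 2) * volume (Λ N)) * volume (Λ N) ≠ ∞ := by
    rw [hVN]
    exact ENNReal.mul_ne_top (ENNReal.mul_ne_top ENNReal.ofReal_ne_top
      (ENNReal.mul_ne_top ENNReal.ofReal_ne_top ENNReal.ofReal_ne_top)) ENNReal.ofReal_ne_top
  have habs := abs_toReal_sub_toReal_le h₁ h₂ (ENNReal.pow_ne_top hL) hE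
  -- pass to real numbers
  have hA : (kernelA1 (volume.restrict (Λ N)) N (σ N)).toReal = ((N : ℝ) * (N / ρ))⁻¹ *
      (∫⁻ p, (‖σ N p.1 p.2‖₊ : ℝ≥0∞)
        ∂(volume.restrict (Λ N)).prod (volume.restrict (Λ N))).toReal := by
    rw [kernelA1, ENNReal.toReal_div, ENNReal.toReal_mul, Measure.restrict_apply_univ, hVN,
      ENNReal.toReal_ofReal hVr.le, ENNReal.toReal_natCast, div_eq_inv_mul]
  have hΨ' : ∫ x in Λ N, ‖Ψ N x‖ = (∫⁻ x in Λ N, (‖Ψ N x‖₊ : ℝ≥0∞)).toReal :=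
    integral_norm_eq_lintegral_enorm (hΨ N).aestronglyMeasurable
  rw [Real.dist_0_eq_abs, hA, hΨ', ← ENNReal.toReal_pow, ← mul_sub, abs_mul, abs_inv,
    abs_of_pos (by positivity : (0 : ℝ) < N * (N / ρ))]
  have hρ0 : ρ ≠ 0 := hρ.ne'
  have hN0' : (N : ℝ) ≠ 0 := hN.ne'
  calc ((N : ℝ) * (N / ρ))⁻¹ * |(∫⁻ p, (‖σ N p.1 p.2‖₊ : ℝ≥0∞)
          ∂(volume.restrict (Λ N)).prod (volume.restrict (Λ N))).toReal -
          ((∫⁻ x in Λ N, (‖Ψ N x‖₊ : ℝ≥0∞)) ^ 2).toReal|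
      ≤ ((N : ℝ) * (N / ρ))⁻¹ *
          (ENNReal.ofReal ρ * (ENNReal.ofReal (ε / 2) * volume (Λ N)) * volume (Λ N)).toReal :=
        mul_le_mul_of_nonneg_left habs (by positivity)
    _ = ε / 2 := by
        simp only [hVN, ENNReal.toReal_mul, ENNReal.toReal_ofReal hρ.le,
          ENNReal.toReal_ofReal (half_pos hε).le, ENNReal.toReal_ofReal hVr.le]
        field_simp
    _ < ε := half_lt_self hε

/-! ## (20)–(22): `n_Ψ ≅ n_M`

Discharge of the named fact `PenroseOnsager1956_eq20` (`PenroseOnsager1956_eq20_holds`): along a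
sequence of systems whose reduced density matrices have the asymptotic form (13)–(14), with the
density bound of (10)–(11) and B.E. condensation present in the form (19), `n_Ψ = ∫_V |Ψ|²` is
asymptotic to the largest eigenvalue `n_M` of `σ₁` (`kernelMaxOccupation`, the variational (21)):
`n_Ψ / n_M → 1`. [cite: PenroseOnsager1956, §4 (20)–(22)]

P–O (§4, after (20)): for a normalised mode `φ`, (21)
`f{φ} ≡ N⁻¹ ⟨φ, σ₁ φ⟩ = N⁻¹ |(φ, Ψ)|² + o(1)`, "since the eigenvalues of `N⁻¹(σ₁ - ΨΨ*)` are
`o(1)` by (17), (8), (12)"; the maximum of the left side is `n_M/N` (attained at `φ_M`), that of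
the first term on the right is `n_Ψ/N` (attained at `φ ∝ Ψ`), whence (20) and (22). We make the
`o(1)` quantitative through the Hilbert–Schmidt norm of `K = σ₁ - ΨΨ*` on `V × V` (this is the
(12)-passage from the `A₁`-type estimate (17) to the `A₂`-type one):

* (21), exact form (`kernelOccupation_eq_add`): `⟨φ,σ₁φ⟩ = (φ,Ψ)(φ,Ψ)* + ⟨φ,Kφ⟩`, the double
  integrals converging absolutely because the kernel is bounded on `V × V` by (10), (13);
* `|⟨φ,Kφ⟩| ≤ ‖φ‖₂² ‖K‖_{HS}` (Cauchy–Schwarz on `V × V`, `enorm_integral_conj_mul_kernel_mul_le`)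
  and `|(φ,Ψ)|² ≤ ‖φ‖₂² n_Ψ`, so `n_M ≤ n_Ψ + ‖K‖_{HS}` (`kernelMaxOccupation_le_lintegral_add`);
  at `φ = Ψ/√n_Ψ` one gets `n_Ψ ≤ n_M + ‖K‖_{HS}` (`lintegral_normSq_le_kernelMaxOccupation_add`);
* `‖K‖²_{HS} ≤ ρ² γ_M ∫_V∫_V γ(|q'-q''|) ≤ ρ² γ_M · V · εV` for `V ≥ V₀(ε)` by (13) and Lemma (15)
  (`setLIntegral_radial_le_of_tendsto_zero`), i.e. `‖K‖_{HS} = o(V)`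
  (`eventually_hilbertSchmidt_le`);
* criterion (19) and Cauchy–Schwarz give `n_Ψ ≥ V (V⁻¹∫_V|Ψ|)² ≥ a₁² V`, so
  `|n_M - n_Ψ| ≤ ‖K‖_{HS} = o(n_Ψ)` and `n_Ψ/n_M → 1` (`tendsto_div_nhds_one_of_abs_sub_le`).

Positivity of `σ₁` is not used (the fact does not assume it); all integrability is derived from
the stated measurability and the bounds (10), (13). -/

/-! ### Generic measure-theoretic lemmas: Cauchy–Schwarz and the Hilbert–Schmidt bound -/

section Generic

variable {X : Type*} [MeasurableSpace X]

/-- Cauchy–Schwarz for lower Lebesgue integrals: `∫ f g ≤ (∫ f²)^{1/2} (∫ g²)^{1/2}`. [folklore] -/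
theorem lintegral_mul_le_sqrt_mul_sqrt (ν : Measure X) {f g : X → ℝ≥0∞} (hf : AEMeasurable f ν)
    (hg : AEMeasurable g ν) :
    ∫⁻ a, f a * g a ∂ν ≤ (∫⁻ a, f a ^ 2 ∂ν) ^ (1 / 2 : ℝ) * (∫⁻ a, g a ^ 2 ∂ν) ^ (1 / 2 : ℝ) := by
  have h := ENNReal.lintegral_mul_le_Lp_mul_Lq ν Real.HolderConjugate.two_two hf hg
  simpa only [Pi.mul_apply, ENNReal.rpow_two] using h

/-- `‖conj z‖ₑ = ‖z‖ₑ`. [folklore] -/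
theorem enorm_conj (z : ℂ) : ‖conj z‖ₑ = ‖z‖ₑ := by
  rw [← ofReal_norm, ← ofReal_norm, Complex.norm_conj]

/-- Cauchy–Schwarz for the pairing `(φ, Ψ) = ∫ φ* Ψ`: `‖∫ φ* Ψ‖ ≤ ‖φ‖₂ ‖Ψ‖₂`. [folklore] -/
theorem enorm_integral_conj_mul_le (ν : Measure X) {φ Ψ : X → ℂ} (hφ : AEStronglyMeasurable φ ν)
    (hΨ : AEStronglyMeasurable Ψ ν) :
    ‖∫ x, conj (φ x) * Ψ x ∂ν‖ₑ ≤
      (∫⁻ x, ‖φ x‖ₑ ^ 2 ∂ν) ^ (1 / 2 : ℝ) * (∫⁻ x, ‖Ψ x‖ₑ ^ 2 ∂ν) ^ (1 / 2 : ℝ) := by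
  calc ‖∫ x, conj (φ x) * Ψ x ∂ν‖ₑ ≤ ∫⁻ x, ‖conj (φ x) * Ψ x‖ₑ ∂ν :=
        enorm_integral_le_lintegral_enorm _
    _ = ∫⁻ x, ‖φ x‖ₑ * ‖Ψ x‖ₑ ∂ν := by simp_rw [enorm_mul, enorm_conj]
    _ ≤ _ := lintegral_mul_le_sqrt_mul_sqrt ν hφ.enorm hΨ.enorm

/-- **Hilbert–Schmidt bound for a quadratic form.** For a kernel `K` on `X × X` and a mode `φ`,
`|∫∫ φ*(x) K(x,y) φ(y)| ≤ ‖φ‖₂² ‖K‖_{HS}`, `‖K‖_{HS} = (∫∫ |K|²)^{1/2}`. [folklore] -/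
theorem enorm_integral_conj_mul_kernel_mul_le (ν : Measure X) [SFinite ν] {φ : X → ℂ}
    {K : X → X → ℂ} (hφ : AEStronglyMeasurable φ ν)
    (hK : AEStronglyMeasurable (fun p : X × X => K p.1 p.2) (ν.prod ν)) :
    ‖∫ p, conj (φ p.1) * K p.1 p.2 * φ p.2 ∂(ν.prod ν)‖ₑ ≤
      (∫⁻ x, ‖φ x‖ₑ ^ 2 ∂ν) * (∫⁻ p, ‖K p.1 p.2‖ₑ ^ 2 ∂(ν.prod ν)) ^ (1 / 2 : ℝ) := by
  have hf : AEMeasurable (fun p : X × X => ‖φ p.1‖ₑ * ‖φ p.2‖ₑ) (ν.prod ν) :=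
    hφ.enorm.comp_fst.mul hφ.enorm.comp_snd
  calc ‖∫ p, conj (φ p.1) * K p.1 p.2 * φ p.2 ∂(ν.prod ν)‖ₑ
      ≤ ∫⁻ p, ‖conj (φ p.1) * K p.1 p.2 * φ p.2‖ₑ ∂(ν.prod ν) :=
        enorm_integral_le_lintegral_enorm _
    _ = ∫⁻ p, (‖φ p.1‖ₑ * ‖φ p.2‖ₑ) * ‖K p.1 p.2‖ₑ ∂(ν.prod ν) := by
        refine lintegral_congr fun p => ?_
        rw [enorm_mul, enorm_mul, enorm_conj]; ring
    _ ≤ (∫⁻ p, (‖φ p.1‖ₑ * ‖φ p.2‖ₑ) ^ 2 ∂(ν.prod ν)) ^ (1 / 2 : ℝ) *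
          (∫⁻ p, ‖K p.1 p.2‖ₑ ^ 2 ∂(ν.prod ν)) ^ (1 / 2 : ℝ) :=
        lintegral_mul_le_sqrt_mul_sqrt _ hf hK.enorm
    _ = _ := by
        have hsq : ∀ a : ℝ≥0∞, (a ^ 2) ^ (1 / 2 : ℝ) = a := fun a => by
          rw [← ENNReal.rpow_two, ← ENNReal.rpow_mul]; norm_num
        congr 1
        simp_rw [mul_pow]
        rw [lintegral_prod_mul (f := fun x => ‖φ x‖ₑ ^ 2) (g := fun x => ‖φ x‖ₑ ^ 2)
          (hφ.enorm.pow_const 2) (hφ.enorm.pow_const 2), ← sq, hsq]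

/-- The rank-one part of the quadratic form: `∫∫ φ*(x) Ψ(x) Ψ*(y) φ(y) = (φ,Ψ) (φ,Ψ)*`.
[folklore] -/
theorem integral_conj_mul_rankOne_mul (ν : Measure X) [SFinite ν] (φ Ψ : X → ℂ) :
    ∫ p, conj (φ p.1) * (Ψ p.1 * conj (Ψ p.2)) * φ p.2 ∂(ν.prod ν) =
      (∫ x, conj (φ x) * Ψ x ∂ν) * conj (∫ x, conj (φ x) * Ψ x ∂ν) := by
  have h1 : (fun p : X × X => conj (φ p.1) * (Ψ p.1 * conj (Ψ p.2)) * φ p.2) =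
      fun p => (conj (φ p.1) * Ψ p.1) * (conj (Ψ p.2) * φ p.2) := by
    funext p; ring
  rw [h1, integral_prod_mul (fun x => conj (φ x) * Ψ x) (fun y => conj (Ψ y) * φ y),
    ← integral_conj]
  congr 1
  refine integral_congr_ae (.of_forall fun x => ?_)
  simp only [map_mul, Complex.conj_conj, mul_comm]

/-- `‖z z*‖ₑ = ‖z‖ₑ²`. [folklore] -/
theorem enorm_mul_conj_self (z : ℂ) : ‖z * conj z‖ₑ = ‖z‖ₑ ^ 2 := by
  rw [enorm_mul, enorm_conj, sq]

/-- A square-integrable mode on a finite measure space is integrable (Cauchy–Schwarz).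
[folklore] -/
theorem integrable_of_lintegral_sq_ne_top (ν : Measure X) [IsFiniteMeasure ν] {φ : X → ℂ}
    (hφ : AEStronglyMeasurable φ ν) (hφ2 : ∫⁻ x, ‖φ x‖ₑ ^ 2 ∂ν ≠ ∞) : Integrable φ ν := by
  refine ⟨hφ, ?_⟩
  have h := lintegral_mul_le_sqrt_mul_sqrt ν hφ.enorm (g := fun _ => 1) aemeasurable_const
  simp only [mul_one, one_pow, lintegral_const, one_mul] at h
  refine lt_of_le_of_lt h (ENNReal.mul_lt_top ?_ ?_)
  · exact ENNReal.rpow_lt_top_of_nonneg (by norm_num) hφ2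
  · exact ENNReal.rpow_lt_top_of_nonneg (by norm_num) (measure_ne_top _ _)

/-- Integrability of `φ*(x) S(x,y) φ(y)` on the product for a bounded kernel `S` and a
square-integrable mode `φ` on a finite measure space. [folklore] -/
theorem integrable_conj_mul_kernel_mul (ν : Measure X) [IsFiniteMeasure ν] {φ : X → ℂ}
    {S : X → X → ℂ} {M : ℝ} (hφ : AEStronglyMeasurable φ ν) (hφ2 : ∫⁻ x, ‖φ x‖ₑ ^ 2 ∂ν ≠ ∞)
    (hS : AEStronglyMeasurable (fun p : X × X => S p.1 p.2) (ν.prod ν))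
    (hM : ∀ᵐ p ∂(ν.prod ν), ‖S p.1 p.2‖ ≤ M) :
    Integrable (fun p : X × X => conj (φ p.1) * S p.1 p.2 * φ p.2) (ν.prod ν) := by
  have hφi : Integrable φ ν := integrable_of_lintegral_sq_ne_top ν hφ hφ2
  have hg : Integrable (fun p : X × X => M * (‖φ p.1‖ * ‖φ p.2‖)) (ν.prod ν) :=
    (hφi.norm.mul_prod hφi.norm).const_mul M
  refine hg.mono' ?_ (hM.mono fun p hp => ?_)
  · exact ((Complex.continuous_conj.comp_aestronglyMeasurable hφ.comp_fst).mul hS).mul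
      hφ.comp_snd
  · rw [norm_mul, norm_mul, Complex.norm_conj]
    calc ‖φ p.1‖ * ‖S p.1 p.2‖ * ‖φ p.2‖ = ‖S p.1 p.2‖ * (‖φ p.1‖ * ‖φ p.2‖) := by ring
      _ ≤ M * (‖φ p.1‖ * ‖φ p.2‖) := by gcongr

end Generic

/-! ### One system: the two-sided estimate `|n_M - n_Ψ| ≤ ‖σ₁ - ΨΨ*‖_{HS}` -/

section OneSystem

variable {Λ : Set Space} {σ : Space → Space → ℂ} {Ψ : Space → ℂ} {γ : ℝ → ℝ} {ρ α γM : ℝ}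

/-- From (13) on the diagonal and the density bound `⟨q|σ₁|q⟩ ≤ αρ`: `|Ψ(q)|² ≤ αρ + ργ_M` on
the container. [cite: PenroseOnsager1956, §4 (10) and (13)] -/
theorem norm_sq_le_of_hasAsymptoticForm (h13 : HasAsymptoticForm ρ σ Ψ γ Λ)
    (hα : ∀ q ∈ Λ, ‖σ q q‖ ≤ α * ρ) (hρ : 0 ≤ ρ) (hγM : ∀ r, γ r ≤ γM) {q : Space}
    (hq : q ∈ Λ) : ‖Ψ q‖ ^ 2 ≤ α * ρ + ρ * γM := by
  have h1 := h13 q hq q hq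
  rw [dist_self] at h1
  have h2 : ‖Ψ q * conj (Ψ q)‖ = ‖Ψ q‖ ^ 2 := by rw [norm_mul, Complex.norm_conj, sq]
  have h3 := norm_sub_norm_le (Ψ q * conj (Ψ q)) (σ q q)
  rw [← norm_sub_rev (σ q q)] at h3
  have h4 : ρ * γ 0 ≤ ρ * γM := mul_le_mul_of_nonneg_left (hγM 0) hρ
  linarith [hα q hq]

/-- The kernel is bounded on the container: `|⟨q'|σ₁|q''⟩| ≤ (αρ + ργ_M) + ργ_M`.
[cite: PenroseOnsager1956, §4 (10) and (13)] -/
theorem norm_kernel_le_of_hasAsymptoticForm (h13 : HasAsymptoticForm ρ σ Ψ γ Λ)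
    (hα : ∀ q ∈ Λ, ‖σ q q‖ ≤ α * ρ) (hρ : 0 ≤ ρ) (hγM : ∀ r, γ r ≤ γM)
    {q' q'' : Space} (hq' : q' ∈ Λ) (hq'' : q'' ∈ Λ) :
    ‖σ q' q''‖ ≤ (α * ρ + ρ * γM) + ρ * γM := by
  have h1 := h13 q' hq' q'' hq''
  have ha := norm_sq_le_of_hasAsymptoticForm h13 hα hρ hγM hq'
  have hb := norm_sq_le_of_hasAsymptoticForm h13 hα hρ hγM hq''
  have h2 : ‖Ψ q' * conj (Ψ q'')‖ ≤ α * ρ + ρ * γM := by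
    rw [norm_mul, Complex.norm_conj]
    nlinarith [sq_nonneg (‖Ψ q'‖ - ‖Ψ q''‖), norm_nonneg (Ψ q'), norm_nonneg (Ψ q'')]
  have h3 : ‖σ q' q''‖ ≤ ‖σ q' q'' - Ψ q' * conj (Ψ q'')‖ + ‖Ψ q' * conj (Ψ q'')‖ := by
    conv_lhs => rw [← sub_add_cancel (σ q' q'') (Ψ q' * conj (Ψ q''))]
    exact norm_add_le _ _
  have h4 : ρ * γ (dist q' q'') ≤ ρ * γM := mul_le_mul_of_nonneg_left (hγM _) hρ
  linarith

/-- Almost every point of `Λ × Λ` (for the product of the restricted Lebesgue measures) lies in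
`Λ × Λ`. [folklore] -/
theorem ae_mem_prod_restrict (hΛ : MeasurableSet Λ) :
    ∀ᵐ p ∂((volume.restrict Λ).prod (volume.restrict Λ)), p.1 ∈ Λ ∧ p.2 ∈ Λ := by
  rw [Measure.prod_restrict]
  exact (ae_restrict_mem (hΛ.prod hΛ)).mono fun p hp => hp

/-- **(21), exact form.** For a square-integrable mode `φ` on the container,
`⟨φ, σ₁ φ⟩ = |(φ, Ψ)|² + ⟨φ, (σ₁ - ΨΨ*) φ⟩` (the double integrals converge absolutely because
the kernel is bounded by (10), (13)). [cite: PenroseOnsager1956, §4 (21)] -/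
theorem kernelOccupation_eq_add (hΛ : MeasurableSet Λ) (hV : volume Λ ≠ ∞)
    (hσ : Measurable (uncurry σ)) (hΨ : AEStronglyMeasurable Ψ (volume.restrict Λ))
    (h13 : HasAsymptoticForm ρ σ Ψ γ Λ) (hα : ∀ q ∈ Λ, ‖σ q q‖ ≤ α * ρ) (hρ : 0 ≤ ρ)
    (hγM : ∀ r, γ r ≤ γM) {φ : Space → ℂ}
    (hφ : AEStronglyMeasurable φ (volume.restrict Λ)) (hφ2 : ∫⁻ x in Λ, ‖φ x‖ₑ ^ 2 ≠ ∞) :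
    kernelOccupation Λ σ φ =
      (∫ x in Λ, conj (φ x) * Ψ x) * conj (∫ x in Λ, conj (φ x) * Ψ x) +
      ∫ p, conj (φ p.1) * (σ p.1 p.2 - Ψ p.1 * conj (Ψ p.2)) * φ p.2
        ∂((volume.restrict Λ).prod (volume.restrict Λ)) := by
  haveI : IsFiniteMeasure (volume.restrict Λ) := isFiniteMeasure_restrict.2 hV
  have hmem := ae_mem_prod_restrict hΛ
  have hF : Integrable (fun p : Space × Space => conj (φ p.1) * σ p.1 p.2 * φ p.2)
      ((volume.restrict Λ).prod (volume.restrict Λ)) :=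
    integrable_conj_mul_kernel_mul _ hφ hφ2 hσ.aestronglyMeasurable
      (hmem.mono fun p hp => norm_kernel_le_of_hasAsymptoticForm h13 hα hρ hγM hp.1 hp.2)
  have hF₁ : Integrable (fun p : Space × Space => conj (φ p.1) * (Ψ p.1 * conj (Ψ p.2)) * φ p.2)
      ((volume.restrict Λ).prod (volume.restrict Λ)) := by
    refine integrable_conj_mul_kernel_mul _ hφ hφ2 (S := fun x y => Ψ x * conj (Ψ y))
      (M := α * ρ + ρ * γM)
      (hΨ.comp_fst.mul (Complex.continuous_conj.comp_aestronglyMeasurable hΨ.comp_snd))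
      (hmem.mono fun p hp => ?_)
    have ha := norm_sq_le_of_hasAsymptoticForm h13 hα hρ hγM hp.1
    have hb := norm_sq_le_of_hasAsymptoticForm h13 hα hρ hγM hp.2
    show ‖Ψ p.1 * conj (Ψ p.2)‖ ≤ α * ρ + ρ * γM
    rw [norm_mul, Complex.norm_conj]
    nlinarith [sq_nonneg (‖Ψ p.1‖ - ‖Ψ p.2‖), norm_nonneg (Ψ p.1), norm_nonneg (Ψ p.2)]
  have hF₂ : Integrable
      (fun p : Space × Space => conj (φ p.1) * (σ p.1 p.2 - Ψ p.1 * conj (Ψ p.2)) * φ p.2)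
      ((volume.restrict Λ).prod (volume.restrict Λ)) := by
    refine (hF.sub hF₁).congr (.of_forall fun p => ?_)
    simp only [Pi.sub_apply]
    ring
  calc kernelOccupation Λ σ φ
      = ∫ p, conj (φ p.1) * σ p.1 p.2 * φ p.2 ∂((volume.restrict Λ).prod (volume.restrict Λ)) :=
        (integral_prod _ hF).symm
    _ = ∫ p, (conj (φ p.1) * (Ψ p.1 * conj (Ψ p.2)) * φ p.2 +
          conj (φ p.1) * (σ p.1 p.2 - Ψ p.1 * conj (Ψ p.2)) * φ p.2)
          ∂((volume.restrict Λ).prod (volume.restrict Λ)) := by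
        congr 1
        funext p
        ring
    _ = _ := by rw [integral_add hF₁ hF₂, integral_conj_mul_rankOne_mul]

/-- Measurability of the kernel `σ₁ - ΨΨ*` on the product. [folklore] -/
theorem aestronglyMeasurable_kernel_sub (hσ : Measurable (uncurry σ))
    (hΨ : AEStronglyMeasurable Ψ (volume.restrict Λ)) :
    AEStronglyMeasurable (fun p : Space × Space => σ p.1 p.2 - Ψ p.1 * conj (Ψ p.2))
      ((volume.restrict Λ).prod (volume.restrict Λ)) :=
  hσ.aestronglyMeasurable.sub
    (hΨ.comp_fst.mul (Complex.continuous_conj.comp_aestronglyMeasurable hΨ.comp_snd))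

/-- **Upper half of (20)–(22)**: `n_M ≤ n_Ψ + ‖σ₁ - ΨΨ*‖_{HS}` — maximise (21) over normalised
modes using `|(φ,Ψ)|² ≤ ‖Ψ‖₂²` and the Hilbert–Schmidt bound for the remainder.
[cite: PenroseOnsager1956, §4 (20)–(22)] -/
theorem kernelMaxOccupation_le_lintegral_add (hΛ : MeasurableSet Λ) (hV : volume Λ ≠ ∞)
    (hσ : Measurable (uncurry σ)) (hΨ : AEStronglyMeasurable Ψ (volume.restrict Λ))
    (h13 : HasAsymptoticForm ρ σ Ψ γ Λ) (hα : ∀ q ∈ Λ, ‖σ q q‖ ≤ α * ρ) (hρ : 0 ≤ ρ)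
    (hγM : ∀ r, γ r ≤ γM) :
    kernelMaxOccupation Λ σ ≤ (∫⁻ x in Λ, ‖Ψ x‖ₑ ^ 2) +
      (∫⁻ p, ‖σ p.1 p.2 - Ψ p.1 * conj (Ψ p.2)‖ₑ ^ 2
        ∂((volume.restrict Λ).prod (volume.restrict Λ))) ^ (1 / 2 : ℝ) := by
  haveI : IsFiniteMeasure (volume.restrict Λ) := isFiniteMeasure_restrict.2 hV
  refine iSup₂_le fun φ hφ => ?_
  obtain ⟨hφm, hφ1⟩ := hφ
  have hφ1' : ∫⁻ x in Λ, ‖φ x‖ₑ ^ 2 = 1 := hφ1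
  change ‖kernelOccupation Λ σ φ‖ₑ ≤ _
  rw [kernelOccupation_eq_add hΛ hV hσ hΨ h13 hα hρ hγM hφm
    (by rw [hφ1']; exact ENNReal.one_ne_top)]
  refine (enorm_add_le _ _).trans (add_le_add ?_ ?_)
  · rw [enorm_mul_conj_self]
    have h := enorm_integral_conj_mul_le (volume.restrict Λ) hφm hΨ
    rw [hφ1', ENNReal.one_rpow, one_mul] at h
    calc ‖∫ x in Λ, conj (φ x) * Ψ x‖ₑ ^ 2
        ≤ ((∫⁻ x in Λ, ‖Ψ x‖ₑ ^ 2) ^ (1 / 2 : ℝ)) ^ 2 := by gcongr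
      _ = _ := by rw [← ENNReal.rpow_two, ← ENNReal.rpow_mul]; norm_num
  · have h := enorm_integral_conj_mul_kernel_mul_le (volume.restrict Λ) hφm
      (aestronglyMeasurable_kernel_sub hσ hΨ) (K := fun x y => σ x y - Ψ x * conj (Ψ y))
    rw [hφ1', one_mul] at h
    exact h

/-- `n_Ψ = ∫_V |Ψ|²` is finite: `Ψ` is bounded on the container of finite volume.
[cite: PenroseOnsager1956, §4 (10), (13), (20)] -/
theorem lintegral_normSq_ne_top (hΛ : MeasurableSet Λ) (hV : volume Λ ≠ ∞)
    (h13 : HasAsymptoticForm ρ σ Ψ γ Λ) (hα : ∀ q ∈ Λ, ‖σ q q‖ ≤ α * ρ) (hρ : 0 ≤ ρ)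
    (hγM : ∀ r, γ r ≤ γM) : ∫⁻ x in Λ, ‖Ψ x‖ₑ ^ 2 ≠ ∞ := by
  refine ne_top_of_le_ne_top (b := ∫⁻ _ in Λ, ENNReal.ofReal (α * ρ + ρ * γM)) ?_ ?_
  · rw [setLIntegral_const]
    exact ENNReal.mul_ne_top ENNReal.ofReal_ne_top hV
  · refine setLIntegral_mono' hΛ fun x hx => ?_
    rw [← ofReal_norm, ← ENNReal.ofReal_pow (norm_nonneg _)]
    exact ENNReal.ofReal_le_ofReal (norm_sq_le_of_hasAsymptoticForm h13 hα hρ hγM hx)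

/-- `∫_V |Ψ|²` as a Bochner integral equals the lower integral `n_Ψ` (as a real number).
[cite: PenroseOnsager1956, §4 (20)] -/
theorem integral_normSq_eq_toReal (hΨ : AEStronglyMeasurable Ψ (volume.restrict Λ)) :
    ∫ x in Λ, ‖Ψ x‖ ^ 2 = (∫⁻ x in Λ, ‖Ψ x‖ₑ ^ 2).toReal := by
  rw [integral_eq_lintegral_of_nonneg_ae (.of_forall fun x => sq_nonneg _)
    ((continuous_pow 2).comp_aestronglyMeasurable hΨ.norm)]
  congr 1
  refine lintegral_congr fun x => ?_
  rw [← ofReal_norm, ENNReal.ofReal_pow (norm_nonneg _)]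

/-- **Lower half of (20)–(22)**: `n_Ψ ≤ n_M + ‖σ₁ - ΨΨ*‖_{HS}` — evaluate (21) at the
normalised mode `φ = Ψ/√n_Ψ`, for which `|(φ,Ψ)|² = n_Ψ`.
[cite: PenroseOnsager1956, §4 (20)–(22)] -/
theorem lintegral_normSq_le_kernelMaxOccupation_add (hΛ : MeasurableSet Λ) (hV : volume Λ ≠ ∞)
    (hσ : Measurable (uncurry σ)) (hΨ : AEStronglyMeasurable Ψ (volume.restrict Λ))
    (h13 : HasAsymptoticForm ρ σ Ψ γ Λ) (hα : ∀ q ∈ Λ, ‖σ q q‖ ≤ α * ρ) (hρ : 0 ≤ ρ)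
    (hγM : ∀ r, γ r ≤ γM) :
    ∫⁻ x in Λ, ‖Ψ x‖ₑ ^ 2 ≤ kernelMaxOccupation Λ σ +
      (∫⁻ p, ‖σ p.1 p.2 - Ψ p.1 * conj (Ψ p.2)‖ₑ ^ 2
        ∂((volume.restrict Λ).prod (volume.restrict Λ))) ^ (1 / 2 : ℝ) := by
  haveI : IsFiniteMeasure (volume.restrict Λ) := isFiniteMeasure_restrict.2 hV
  have hNtop := lintegral_normSq_ne_top hΛ hV h13 hα hρ hγM (Ψ := Ψ)
  set NΨ := ∫⁻ x in Λ, ‖Ψ x‖ₑ ^ 2 with hNΨ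
  rcases eq_or_ne NΨ 0 with h0 | h0
  · rw [h0]; exact bot_le
  set t : ℝ := NΨ.toReal with ht
  have htpos : 0 < t := ENNReal.toReal_pos h0 hNtop
  set c : ℝ := (Real.sqrt t)⁻¹ with hc
  have hc0 : 0 ≤ c := by positivity
  set φ : Space → ℂ := fun x => (c : ℂ) * Ψ x with hφdef
  have hφm : AEStronglyMeasurable φ (volume.restrict Λ) := aestronglyMeasurable_const.mul hΨ
  have hcc : ‖(c : ℂ)‖ₑ ^ 2 = ENNReal.ofReal t⁻¹ := by
    rw [← ofReal_norm, Complex.norm_real, Real.norm_of_nonneg hc0,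
      ← ENNReal.ofReal_pow hc0, hc, inv_pow, Real.sq_sqrt htpos.le]
  have hφ2 : ∫⁻ x in Λ, ‖φ x‖ₑ ^ 2 = 1 := by
    simp only [hφdef, enorm_mul, mul_pow]
    rw [lintegral_const_mul' _ _ (by simp), hcc, ← hNΨ, ← ENNReal.ofReal_toReal hNtop, ← ht,
      ← ENNReal.ofReal_mul (by positivity), inv_mul_cancel₀ htpos.ne', ENNReal.ofReal_one]
  -- the pairing `(φ, Ψ) = c ∫|Ψ|² = c t`
  have hΨΨ : ∫ x in Λ, conj (Ψ x) * Ψ x = (t : ℂ) := by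
    have h1 : (fun x => conj (Ψ x) * Ψ x) = fun x => ((‖Ψ x‖ ^ 2 : ℝ) : ℂ) := by
      funext x
      rw [Complex.conj_mul']
      push_cast
      rfl
    rw [h1, integral_complex_ofReal, integral_normSq_eq_toReal hΨ]
  have hz : ∫ x in Λ, conj (φ x) * Ψ x = (c : ℂ) * t := by
    simp only [hφdef, map_mul, Complex.conj_ofReal, mul_assoc]
    rw [integral_const_mul, hΨΨ]
  have hzz : ‖(∫ x in Λ, conj (φ x) * Ψ x) * conj (∫ x in Λ, conj (φ x) * Ψ x)‖ₑ = NΨ := by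
    rw [enorm_mul_conj_self, hz, ← ofReal_norm, ← ENNReal.ofReal_pow (norm_nonneg _)]
    have h1 : ‖(c : ℂ) * (t : ℂ)‖ ^ 2 = t := by
      rw [← Complex.ofReal_mul, Complex.norm_real, Real.norm_of_nonneg (by positivity), mul_pow,
        hc, inv_pow, Real.sq_sqrt htpos.le]
      field_simp
    rw [h1, ht, ENNReal.ofReal_toReal hNtop]
  have hdec := kernelOccupation_eq_add hΛ hV hσ hΨ h13 hα hρ hγM hφm
    (by rw [hφ2]; exact ENNReal.one_ne_top)
  have heq : (∫ x in Λ, conj (φ x) * Ψ x) * conj (∫ x in Λ, conj (φ x) * Ψ x) =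
      kernelOccupation Λ σ φ - ∫ p, conj (φ p.1) * (σ p.1 p.2 - Ψ p.1 * conj (Ψ p.2)) * φ p.2
        ∂((volume.restrict Λ).prod (volume.restrict Λ)) := by
    rw [hdec]; ring
  have hR := enorm_integral_conj_mul_kernel_mul_le (volume.restrict Λ) hφm
    (aestronglyMeasurable_kernel_sub hσ hΨ) (K := fun x y => σ x y - Ψ x * conj (Ψ y))
  rw [hφ2, one_mul] at hR
  calc NΨ = _ := hzz.symm
    _ = _ := by rw [heq]
    _ ≤ ‖kernelOccupation Λ σ φ‖ₑ + _ := enorm_sub_le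
    _ ≤ _ := add_le_add (nnnorm_kernelOccupation_le σ hφm hφ2) hR

/-- Cauchy–Schwarz on the container: `[∫_V |Ψ|]² ≤ V ∫_V |Ψ|²` ("the square of the mean value
cannot exceed the mean value of the square", as in (9)). [folklore] -/
theorem sq_integral_norm_le (hV : volume Λ ≠ ∞) (hΨ : AEStronglyMeasurable Ψ (volume.restrict Λ))
    (hN : ∫⁻ x in Λ, ‖Ψ x‖ₑ ^ 2 ≠ ∞) :
    (∫ x in Λ, ‖Ψ x‖) ^ 2 ≤ (volume Λ).toReal * ∫ x in Λ, ‖Ψ x‖ ^ 2 := by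
  have h := lintegral_sq_le_mul_lintegral_sq (volume.restrict Λ) hΨ.enorm
  rw [Measure.restrict_apply_univ] at h
  rw [integral_norm_eq_lintegral_enorm hΨ, integral_normSq_eq_toReal hΨ, ← ENNReal.toReal_pow,
    ← ENNReal.toReal_mul]
  exact ENNReal.toReal_mono (ENNReal.mul_ne_top hV hN) h

/-- **(17) in Hilbert–Schmidt form.** By (13), `∫_V∫_V |⟨q'|σ₁|q''⟩ - Ψ(q')Ψ*(q'')|² ≤
ρ² γ_M ∫_V ∫_V γ(|q'' - q'|)` (`γ ≤ γ_M`; the error profile `γ` is not assumed measurable, so the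
Tonelli step is the inequality `lintegral_prod_le`). [cite: PenroseOnsager1956, §4 (13), (17)] -/
theorem lintegral_kernel_sub_sq_le (hΛ : MeasurableSet Λ) (h13 : HasAsymptoticForm ρ σ Ψ γ Λ)
    (hγ0 : ∀ r, 0 ≤ γ r) (hγM : ∀ r, γ r ≤ γM) :
    ∫⁻ p, ‖σ p.1 p.2 - Ψ p.1 * conj (Ψ p.2)‖ₑ ^ 2
        ∂((volume.restrict Λ).prod (volume.restrict Λ)) ≤
      ENNReal.ofReal (ρ ^ 2 * γM) *
        ∫⁻ q' in Λ, ∫⁻ q'' in Λ, ENNReal.ofReal (γ (dist q'' q')) := by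
  have hmem := ae_mem_prod_restrict hΛ
  have hγM0 : 0 ≤ γM := (hγ0 0).trans (hγM 0)
  calc ∫⁻ p, ‖σ p.1 p.2 - Ψ p.1 * conj (Ψ p.2)‖ₑ ^ 2
        ∂((volume.restrict Λ).prod (volume.restrict Λ))
      ≤ ∫⁻ p, ENNReal.ofReal (ρ ^ 2 * γM) * ENNReal.ofReal (γ (dist p.2 p.1))
        ∂((volume.restrict Λ).prod (volume.restrict Λ)) := by
        refine lintegral_mono_ae (hmem.mono fun p hp => ?_)
        rw [← ofReal_norm, ← ENNReal.ofReal_pow (norm_nonneg _),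
          ← ENNReal.ofReal_mul (mul_nonneg (sq_nonneg ρ) hγM0)]
        refine ENNReal.ofReal_le_ofReal ?_
        have h1 := h13 p.1 hp.1 p.2 hp.2
        have hγd := hγ0 (dist p.1 p.2)
        rw [dist_comm p.2]
        calc ‖σ p.1 p.2 - Ψ p.1 * conj (Ψ p.2)‖ ^ 2 ≤ (ρ * γ (dist p.1 p.2)) ^ 2 :=
              pow_le_pow_left₀ (norm_nonneg _) h1 2
          _ = ρ ^ 2 * (γ (dist p.1 p.2) * γ (dist p.1 p.2)) := by ring
          _ ≤ ρ ^ 2 * (γM * γ (dist p.1 p.2)) := by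
              gcongr
              exact hγM _
          _ = ρ ^ 2 * γM * γ (dist p.1 p.2) := by ring
    _ = ENNReal.ofReal (ρ ^ 2 * γM) * ∫⁻ p, ENNReal.ofReal (γ (dist p.2 p.1))
        ∂((volume.restrict Λ).prod (volume.restrict Λ)) :=
        lintegral_const_mul' _ _ ENNReal.ofReal_ne_top
    _ ≤ _ := by
        gcongr
        exact lintegral_prod_le (fun p : Space × Space => ENNReal.ofReal (γ (dist p.2 p.1)))

end OneSystem

/-! ### Along the sequence of systems: (20) `n_Ψ ≅ n_M` -/

/-- **(17) ⇒ `‖σ₁ - ΨΨ*‖_{HS} = o(V)`.** Along the sequence of systems (containers of volume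
`V = N/ρ → ∞`), for every `ε > 0` eventually `(∫∫|σ₁ - ΨΨ*|²)^{1/2} ≤ ε V`: by (13),
`|σ₁ - ΨΨ*|² ≤ ρ² γ_M γ`, and Lemma (15) bounds `∫_V γ(|x'-x|) d³x' ≤ ε' V` uniformly in `x`.
[cite: PenroseOnsager1956, §4 (15)–(17)] -/
theorem eventually_hilbertSchmidt_le {ρ : ℝ} {Λ : ℕ → Set Space} {σ : ℕ → Space → Space → ℂ}
    {Ψ : ℕ → Space → ℂ} {γ : ℝ → ℝ} {γM : ℝ} (hρ : 0 < ρ) (hΛ : ∀ N, MeasurableSet (Λ N))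
    (hV : ∀ᶠ N : ℕ in atTop, volume (Λ N) = ENNReal.ofReal (N / ρ))
    (hγ0 : ∀ r, 0 ≤ γ r) (hγM : ∀ r, γ r ≤ γM) (hγ : Tendsto γ atTop (𝓝 0))
    (h13 : ∀ᶠ N in atTop, HasAsymptoticForm ρ (σ N) (Ψ N) γ (Λ N)) {ε : ℝ} (hε : 0 < ε) :
    ∀ᶠ N : ℕ in atTop,
      (∫⁻ p, ‖σ N p.1 p.2 - Ψ N p.1 * conj (Ψ N p.2)‖ₑ ^ 2
        ∂((volume.restrict (Λ N)).prod (volume.restrict (Λ N)))) ^ (1 / 2 : ℝ) ≤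
      ENNReal.ofReal ε * volume (Λ N) := by
  have hγM0 : 0 ≤ γM := (hγ0 0).trans (hγM 0)
  have hc0 : 0 ≤ ρ ^ 2 * γM := mul_nonneg (sq_nonneg ρ) hγM0
  set ε₂ : ℝ := ε ^ 2 / (ρ ^ 2 * γM + 1) with hε₂
  have hε₂pos : 0 < ε₂ := div_pos (pow_pos hε 2) (by linarith)
  obtain ⟨V₀, hV₀, hL⟩ :=
    setLIntegral_radial_le_of_tendsto_zero (volume : Measure Space) hγ0 hγM hγ hε₂pos
  have hlarge : ∀ᶠ N : ℕ in atTop, V₀ ≤ volume (Λ N) := by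
    have ht : Tendsto (fun N : ℕ => (N : ℝ) / ρ) atTop atTop :=
      tendsto_natCast_atTop_atTop.atTop_div_const hρ
    filter_upwards [hV, ht.eventually_ge_atTop V₀.toReal] with N hVN hN
    rw [hVN, ← ENNReal.ofReal_toReal hV₀]
    exact ENNReal.ofReal_le_ofReal hN
  filter_upwards [hlarge, h13] with N hN h13N
  have hE := lintegral_kernel_sub_sq_le (hΛ N) h13N hγ0 hγM
  have hinner : ∫⁻ q' in Λ N, ∫⁻ q'' in Λ N, ENNReal.ofReal (γ (dist q'' q')) ≤
      ENNReal.ofReal ε₂ * volume (Λ N) * volume (Λ N) := by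
    calc ∫⁻ q' in Λ N, ∫⁻ q'' in Λ N, ENNReal.ofReal (γ (dist q'' q'))
        ≤ ∫⁻ _ in Λ N, ENNReal.ofReal ε₂ * volume (Λ N) :=
          lintegral_mono fun q' => hL (Λ N) (hΛ N) hN q'
      _ = _ := setLIntegral_const _ _
  have hE2 : ∫⁻ p, ‖σ N p.1 p.2 - Ψ N p.1 * conj (Ψ N p.2)‖ₑ ^ 2
        ∂((volume.restrict (Λ N)).prod (volume.restrict (Λ N))) ≤
      (ENNReal.ofReal ε * volume (Λ N)) ^ 2 := by
    calc _ ≤ _ := hE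
      _ ≤ ENNReal.ofReal (ρ ^ 2 * γM) * (ENNReal.ofReal ε₂ * volume (Λ N) * volume (Λ N)) := by
          gcongr
      _ = ENNReal.ofReal (ρ ^ 2 * γM * ε₂) * (volume (Λ N) * volume (Λ N)) := by
          rw [ENNReal.ofReal_mul hc0]; ring
      _ ≤ ENNReal.ofReal (ε ^ 2) * (volume (Λ N) * volume (Λ N)) := by
          gcongr
          calc ρ ^ 2 * γM * ε₂ ≤ (ρ ^ 2 * γM + 1) * ε₂ := by gcongr; linarith
            _ = ε ^ 2 := by rw [hε₂]; field_simp
      _ = (ENNReal.ofReal ε * volume (Λ N)) ^ 2 := by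
          rw [mul_pow, ← ENNReal.ofReal_pow hε.le, sq (volume (Λ N))]
  calc _ ≤ ((ENNReal.ofReal ε * volume (Λ N)) ^ 2) ^ (1 / 2 : ℝ) :=
        ENNReal.rpow_le_rpow hE2 (by norm_num)
    _ = _ := by rw [← ENNReal.rpow_two, ← ENNReal.rpow_mul]; norm_num

/-- The elementary limit behind (20): if eventually `|m - n| ≤ d`, `n > 0` and `d ≤ ε n` for
every `ε > 0`, then `n / m → 1`. [folklore] -/
theorem tendsto_div_nhds_one_of_abs_sub_le {n m d : ℕ → ℝ}
    (h1 : ∀ᶠ N in atTop, m N ≤ n N + d N) (h2 : ∀ᶠ N in atTop, n N ≤ m N + d N)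
    (hn : ∀ᶠ N in atTop, 0 < n N) (hd : ∀ ε, 0 < ε → ∀ᶠ N in atTop, d N ≤ ε * n N) :
    Tendsto (fun N => n N / m N) atTop (𝓝 1) := by
  have hmn : Tendsto (fun N => m N / n N) atTop (𝓝 1) := by
    rw [Metric.tendsto_nhds]
    intro ε hε
    filter_upwards [h1, h2, hn, hd (ε / 2) (half_pos hε)] with N hN1 hN2 hN0 hNd
    rw [Real.dist_eq, abs_lt]
    have hεn : 0 < ε * n N := mul_pos hε hN0
    constructor
    · rw [lt_sub_iff_add_lt, lt_div_iff₀ hN0]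
      nlinarith
    · rw [sub_lt_iff_lt_add, div_lt_iff₀ hN0]
      nlinarith
  have h := hmn.inv₀ one_ne_zero
  rw [inv_one] at h
  refine h.congr' (.of_forall fun N => ?_)
  simp only [inv_div]

/-- **Penrose–Onsager (20): `n_Ψ ≅ n_M`** — discharge of the named fact
`PenroseOnsager1956_eq20`. With `K = σ₁ - ΨΨ*`: for every normalised mode,
`|⟨φ,σ₁φ⟩ - |(φ,Ψ)|²| ≤ ‖K‖_{HS}` ((21) with the Hilbert–Schmidt bound), whence
`|n_M - n_Ψ| ≤ ‖K‖_{HS}` (upper bound by `|(φ,Ψ)|² ≤ n_Ψ`, lower bound at `φ = Ψ/√n_Ψ`);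
`‖K‖_{HS} = o(V)` by (13) and Lemma (15); and `n_Ψ ≥ V (V⁻¹∫|Ψ|)² ≥ a₁² V` by Cauchy–Schwarz and
criterion (19). Hence `n_Ψ/n_M → 1`. [cite: PenroseOnsager1956, §4 (20)–(22)] -/
theorem PenroseOnsager1956_eq20_holds : PenroseOnsager1956_eq20 := by
  intro ρ α Λ σ Ψ γ γM hρ hΛ hV hσ hΨ hγ0 hγM hγ h13 hα hBEC
  obtain ⟨a₁, a₂, ha₁, hBEC⟩ := hBEC
  -- the Hilbert–Schmidt size of `σ₁ - ΨΨ*` and its real shadow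
  set HS : ℕ → ℝ≥0∞ := fun N => (∫⁻ p, ‖σ N p.1 p.2 - Ψ N p.1 * conj (Ψ N p.2)‖ₑ ^ 2
    ∂((volume.restrict (Λ N)).prod (volume.restrict (Λ N)))) ^ (1 / 2 : ℝ) with hHS
  have hK1 : ∀ᶠ N : ℕ in atTop, HS N ≤ ENNReal.ofReal 1 * volume (Λ N) :=
    eventually_hilbertSchmidt_le hρ hΛ hV hγ0 hγM hγ h13 one_pos
  have hbase : ∀ᶠ N : ℕ in atTop,
      (kernelMaxOccupation (Λ N) (σ N)).toReal ≤ (∫ x in Λ N, ‖Ψ N x‖ ^ 2) + (HS N).toReal ∧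
      (∫ x in Λ N, ‖Ψ N x‖ ^ 2) ≤ (kernelMaxOccupation (Λ N) (σ N)).toReal + (HS N).toReal ∧
      a₁ ^ 2 * (volume (Λ N)).toReal < (∫ x in Λ N, ‖Ψ N x‖ ^ 2) ∧
      volume (Λ N) ≠ ∞ := by
    filter_upwards [hV, h13, hα, hBEC, hK1, eventually_gt_atTop 0]
      with N hVN h13N hαN hBN hK1N hN0
    have hVtop : volume (Λ N) ≠ ∞ := by rw [hVN]; exact ENNReal.ofReal_ne_top
    have hvpos : 0 < (volume (Λ N)).toReal := by
      rw [hVN, ENNReal.toReal_ofReal (by positivity)]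
      have : (0 : ℝ) < N := Nat.cast_pos.2 hN0
      positivity
    have hNtop := lintegral_normSq_ne_top (hΛ N) hVtop h13N hαN hρ.le hγM
    have hHStop : HS N ≠ ∞ :=
      ne_top_of_le_ne_top (ENNReal.mul_ne_top ENNReal.ofReal_ne_top hVtop) hK1N
    have hup := kernelMaxOccupation_le_lintegral_add (hΛ N) hVtop (hσ N) (hΨ N) h13N hαN hρ.le
      hγM
    have hlo := lintegral_normSq_le_kernelMaxOccupation_add (hΛ N) hVtop (hσ N) (hΨ N) h13N hαN
      hρ.le hγM
    have hMtop : kernelMaxOccupation (Λ N) (σ N) ≠ ∞ :=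
      ne_top_of_le_ne_top (ENNReal.add_ne_top.2 ⟨hNtop, hHStop⟩) hup
    have hn : ∫ x in Λ N, ‖Ψ N x‖ ^ 2 = (∫⁻ x in Λ N, ‖Ψ N x‖ₑ ^ 2).toReal :=
      integral_normSq_eq_toReal (hΨ N)
    refine ⟨?_, ?_, ?_, hVtop⟩
    · rw [hn, ← ENNReal.toReal_add hNtop hHStop]
      exact ENNReal.toReal_mono (ENNReal.add_ne_top.2 ⟨hNtop, hHStop⟩) hup
    · rw [hn, ← ENNReal.toReal_add hMtop hHStop]
      exact ENNReal.toReal_mono (ENNReal.add_ne_top.2 ⟨hMtop, hHStop⟩) hlo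
    · have hcs := sq_integral_norm_le hVtop (hΨ N) hNtop
      obtain ⟨hB1, -⟩ := hBN
      rw [inv_mul_eq_div, lt_div_iff₀ hvpos] at hB1
      have h1 : (a₁ * (volume (Λ N)).toReal) ^ 2 < (∫ x in Λ N, ‖Ψ N x‖) ^ 2 :=
        pow_lt_pow_left₀ hB1 (by positivity) two_ne_zero
      nlinarith
  have hd : ∀ ε, 0 < ε → ∀ᶠ N : ℕ in atTop, (HS N).toReal ≤ ε * ∫ x in Λ N, ‖Ψ N x‖ ^ 2 := by
    intro ε hε
    filter_upwards [hbase, eventually_hilbertSchmidt_le hρ hΛ hV hγ0 hγM hγ h13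
      (ε := ε * a₁ ^ 2) (by positivity)] with N hb hKN
    obtain ⟨-, -, hlow, hVtop⟩ := hb
    calc (HS N).toReal ≤ (ENNReal.ofReal (ε * a₁ ^ 2) * volume (Λ N)).toReal :=
          ENNReal.toReal_mono (ENNReal.mul_ne_top ENNReal.ofReal_ne_top hVtop) hKN
      _ = ε * (a₁ ^ 2 * (volume (Λ N)).toReal) := by
          rw [ENNReal.toReal_mul, ENNReal.toReal_ofReal (by positivity), mul_assoc]
      _ ≤ ε * ∫ x in Λ N, ‖Ψ N x‖ ^ 2 := by gcongr
  refine tendsto_div_nhds_one_of_abs_sub_le (n := fun N => ∫ x in Λ N, ‖Ψ N x‖ ^ 2)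
    (m := fun N => (kernelMaxOccupation (Λ N) (σ N)).toReal) (d := fun N => (HS N).toReal)
    (hbase.mono fun N h => h.1) (hbase.mono fun N h => h.2.1) (hbase.mono fun N h => ?_) hd
  exact lt_of_le_of_lt (by positivity) h.2.2.1

end Literature.MathematicalPhysics.QuantumManyBody.BoseGas.PenroseOnsager

end
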